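import Literature.NumberTheory.EllipticCurves.ZpExtensionEisensteinTwistCores
import Literature.NumberTheory.GaloisRepresentations.ContinuousCorestrictionLocalTriviality
import Literature.NumberTheory.GaloisRepresentations.BlochKatoSelmerGroup
import HarnessLib

/-!
# The finite-level control map preserves local triviality: `coresEisenstein N θ` dies along every
# `φ : Γ_L → Γ_K` along which all conjugates of `θ` die; in particular it is UNRAMIFIED at `v` when `θ` is
# unramified at every place above `v` (theorems + one plumbing definition; no named fact)

Topic `NumberTheory/EllipticCurves` (sequel of `ZpExtensionEisensteinTwistCores`; consumer of the TopRep-currency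
Mackey formula `ContinuousCorestrictionLocalTriviality.map_cores_eq_zero`). Cell `pub/bsd-print-x9`, D1 road of the
shared μ-residual of rows 9/10: the «v ∤ p, unramified» half of the Selmer compatibility `f(𝔖) ⊆ H¹_{F_𝔮}(K, T_𝔮)`
of the compact control map (the Selmer structure `F_𝔮` is unramified at the finite places outside `S ∪ {v ∣ p}`).

For `κ : ZpExtension K p`, `ρ : DiscreteGaloisModule K M`, `m ≥ 1`, `k`, `J = eisensteinLevel hm k`, an open normal
subgroup `N ≤ Γ_J` of finite index and `θ ∈ H¹(N, M)`:

* `idPairHom ρ' φ : res_φ ρ' ⟶ ρ'|_φ` — the identity coefficient morphism of `galoisCohomology.pullback`.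
* **`pullback_coresEisenstein_eq_zero`**: for any field `L` and continuous `φ : Γ_L → Γ_K`, if every conjugate
  `g · θ` dies along `φ| : φ⁻¹N → N` (in `H¹(φ⁻¹N, M)`), then `galoisCohomology.pullback _ φ 1 (coresEisenstein N θ) = 0`
  in `H¹(Γ_L, M ⊗ A_{m,k}(ψ))`. Mechanism: Mackey (`map_cores_eq_zero`) for `cor_N^{Γ_K} ∘ H¹(a ↦ 1 ⊗ a)`; the
  conjugate `g · (1 ⊗ θ)` is `(1+T)^{κ(g) mod p^J} • (1 ⊗ (g · θ))` (`eisensteinTwist_eisensteinUnitCoeff`), and a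
  coboundary `h ↦ φ(h)·a − a` of `M` on `φ⁻¹N` maps to the coboundary of `(1+T)^e • (1 ⊗ a)` because `φ⁻¹N` acts on
  `1 ⊗ M` through `ρ` (`N ≤ Γ_J`, `eisensteinTwist_eisensteinUnitCoeff_of_mem`). NO hypothesis on the ramification
  of the twisting character is needed.
* **`res_coresEisenstein_mem_unramifiedSubgroup`** (`K` a number field, `v` a finite place): with
  `φ = Γ_{(K_v)^{ur}} → Γ_{K_v} → Γ_K`, the localisation of `coresEisenstein N θ` at `v` lies in
  `unramifiedSubgroup (GaloisRep.toLocal v (κ.eisensteinTwist ρ hm k)) 1` whenever every conjugate of `θ` dies on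
  `Γ_{(K_v)^{ur}} ×_{Γ_K} N` — «the corestriction of a class of `K̄^N` unramified at every place above `v` is unramified
  at `v`» for Howard's `T_𝔮/p^k T_𝔮` [Howard 2004, §2.2, Lemma 2.2.7: the local conditions of `F_𝔮` at `v ∤ p`].

BSD is not proved by any of this.

References: [NeukirchSchmidtWingberg2008] I §5 (1.5.6)–(1.5.7); [SerreLocalFields1979] VII §5–§7;
[Howard2004HeegnerKolyvagin] §2.1 (Selmer structures, unramified conditions), §2.2, Lemma 2.2.7; [MilneADT2006] I §4.
-/

noncomputable section

open scoped TensorProduct Topology ContRepresentation Classical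
open Field CategoryTheory NumberField IsDedekindDomain

universe u

namespace Literature.NumberTheory.EllipticCurves

open Literature.NumberTheory.GaloisRepresentations
open Literature.NumberTheory.GaloisRepresentations.DiscreteGaloisModule (unramifiedSubgroup)

namespace ZpExtension

variable {K : Type u} [Field K] {p : ℕ} [hp : Fact p.Prime] (κ : ZpExtension K p)
variable {M : Type u} [AddCommGroup M] [TopologicalSpace M] [DiscreteTopology M]

/-! ## §1 The identity coefficient morphism of a pull-back -/

section IdPair

variable {L : Type u} [Field L]

/-- The identity coefficient morphism `res_φ ρ' ⟶ ρ'|_φ` (`ρ'|_φ = ContinuousRep.restrict ρ' φ`) along a continuous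
`φ : Γ_L → Γ_K` — the morphism `galoisCohomology.pullback ρ' φ` is `ContinuousCohomology.map φ` of.
[cite: SerreLocalFields1979, VII §5] -/
def idPairHom {M' : Type u} [AddCommGroup M'] [TopologicalSpace M'] [DiscreteTopology M']
    (ρ' : DiscreteGaloisModule K M') (φ : absoluteGaloisGroup L →ₜ* absoluteGaloisGroup K) :
    TopRep.res (φ : absoluteGaloisGroup L →* absoluteGaloisGroup K) ρ'.toTopRep ⟶
      DiscreteGaloisModule.toTopRep (ContinuousRep.restrict ρ' φ) :=
  TopRep.ofHom ⟨ContinuousLinearMap.id ℤ M', fun _ ↦ rfl⟩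

/-- `idPairHom` is the identity on elements. [cite: SerreLocalFields1979, VII §5] -/
@[simp] theorem idPairHom_hom_apply {M' : Type u} [AddCommGroup M'] [TopologicalSpace M'] [DiscreteTopology M']
    (ρ' : DiscreteGaloisModule K M') (φ : absoluteGaloisGroup L →ₜ* absoluteGaloisGroup K) (x : M') :
    (idPairHom ρ' φ).hom x = x := rfl

/-- `galoisCohomology.pullback ρ' φ 1` is `ContinuousCohomology.map φ (idPairHom ρ' φ) 1` (definitional).
[cite: SerreLocalFields1979, VII §5] -/
theorem pullback_eq_map_idPairHom {M' : Type u} [AddCommGroup M'] [TopologicalSpace M'] [DiscreteTopology M']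
    (ρ' : DiscreteGaloisModule K M') (φ : absoluteGaloisGroup L →ₜ* absoluteGaloisGroup K)
    (c : galoisCohomology ρ' 1) :
    galoisCohomology.pullback ρ' φ 1 c = ContinuousCohomology.map φ (idPairHom ρ' φ) 1 c := rfl

end IdPair

/-! ## §2 `coresEisenstein` preserves local triviality along any `φ : Γ_L → Γ_K` -/

section Pullback

variable (ρ : DiscreteGaloisModule K M) {m : ℕ} (hm : 1 ≤ m) (k : ℕ)
  (N : Subgroup (absoluteGaloisGroup K)) [N.Normal] (hN : N ≤ κ.layerSubgroup (eisensteinLevel (p := p) hm k))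
  (hNo : IsOpen (N : Set (absoluteGaloisGroup K))) [Fintype (absoluteGaloisGroup K ⧸ N)]
  {L : Type u} [Field L] (φ : absoluteGaloisGroup L →ₜ* absoluteGaloisGroup K)

/-- **`coresEisenstein` preserves local triviality along `φ`.** If every conjugate `g · θ` (`g ∈ Γ_K`) of
`θ ∈ H¹(N, M)` dies along `φ| : φ⁻¹N → N`, then `cor_N^{Γ_K}(1 ⊗ θ) ∈ H¹(K, M ⊗ A_{m,k}(ψ))` dies along `φ`:
`galoisCohomology.pullback _ φ 1 (coresEisenstein N θ) = 0`. (Mackey `map_cores_eq_zero`; `g · (1 ⊗ θ) =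
(1+T)^{κ(g) mod p^J} • (1 ⊗ g·θ)`; coboundaries of `M` on `φ⁻¹N ≤ N ≤ Γ_J` map to coboundaries since `Γ_J` acts on
`1 ⊗ M` through `ρ`.) [cite: NeukirchSchmidtWingberg2008, I §5 (1.5.6)–(1.5.7)] [cite: Howard2004HeegnerKolyvagin, §2.2] -/
theorem pullback_coresEisenstein_eq_zero [Fintype (absoluteGaloisGroup L ⧸ N.comap (φ : _ →* _))]
    (θ : continuousCohomology 1 (subgroupRep ρ.toTopRep N))
    (hθ : ∀ g : absoluteGaloisGroup K,
      ContinuousCohomology.map (comapRestrict N φ)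
        (resPairHom ρ.toTopRep (DiscreteGaloisModule.toTopRep (ContinuousRep.restrict ρ φ)) φ (idPairHom ρ φ) N) 1
        (conjMap ρ.toTopRep N g 1 θ) = 0) :
    galoisCohomology.pullback (κ.eisensteinTwist ρ hm k) φ 1 (κ.coresEisenstein ρ hm k N hN hNo θ) = 0 := by
  rw [pullback_eq_map_idPairHom, coresEisenstein_apply]
  refine map_cores_eq_zero (κ.eisensteinTwist ρ hm k).toTopRep _ φ (idPairHom (κ.eisensteinTwist ρ hm k) φ) N hNo _
    fun g ↦ ?_
  obtain ⟨c, rfl⟩ := oneCocycleClass_surjective _ θ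
  -- the hypothesis on cocycles: `h ↦ ρ g (c (g⁻¹ φ(h) g))` is the coboundary of some `a ∈ M` on `φ⁻¹N`
  have h0 := hθ g
  rw [conjMap_oneCocycleClass, map_oneCocycleClass, oneCocycleClass_eq_zero_iff] at h0
  obtain ⟨a, ha⟩ := h0
  rw [cohomologyMap_oneCocycleClass, conjMap_oneCocycleClass, map_oneCocycleClass, oneCocycleClass_eq_zero_iff]
  refine ⟨IwasawaAlgebra.EisensteinCoeff.onePlusT p m k ^ κ.twistExponent (eisensteinLevel (p := p) hm k) g •
    eisensteinUnitCoeff p m k a, fun h ↦ ?_⟩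
  have hah := ha h
  rw [contOneCocycles.pullback_apply, resPairHom_hom_apply, idPairHom_hom_apply, conj_pullback_apply,
    ContinuousRep.toTopRep_ρ_apply] at hah
  have hmem : (φ : absoluteGaloisGroup L →ₜ* absoluteGaloisGroup K) (h : absoluteGaloisGroup L) ∈
      κ.layerSubgroup (eisensteinLevel (p := p) hm k) := hN h.2
  rw [contOneCocycles.pullback_apply, resPairHom_hom_apply, idPairHom_hom_apply, conj_pullback_apply,
    pullback_id_resIdHom_apply, eisensteinUnitCoeffHom_hom_apply, ContinuousRep.toTopRep_ρ_apply,
    eisensteinTwist_eisensteinUnitCoeff, hah, map_sub, smul_sub]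
  change _ • eisensteinUnitCoeff p m k (ρ (φ (h : absoluteGaloisGroup L)) a) - _ =
    κ.eisensteinTwist ρ hm k (φ (h : absoluteGaloisGroup L)) (_ • eisensteinUnitCoeff p m k a) - _
  rw [κ.eisensteinTwist_apply_smul ρ hm k, κ.eisensteinTwist_eisensteinUnitCoeff_of_mem ρ hm k hmem]

/-- The same with the finiteness structure on `Γ_L ⧸ φ⁻¹N` supplied from `Γ_K ⧸ N`
(`finite_quotientComap`). [cite: NeukirchSchmidtWingberg2008, I §5 (1.5.6)–(1.5.7)] -/
theorem pullback_coresEisenstein_eq_zero' (θ : continuousCohomology 1 (subgroupRep ρ.toTopRep N))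
    (hθ : ∀ g : absoluteGaloisGroup K,
      ContinuousCohomology.map (comapRestrict N φ)
        (resPairHom ρ.toTopRep (DiscreteGaloisModule.toTopRep (ContinuousRep.restrict ρ φ)) φ (idPairHom ρ φ) N) 1
        (conjMap ρ.toTopRep N g 1 θ) = 0) :
    galoisCohomology.pullback (κ.eisensteinTwist ρ hm k) φ 1 (κ.coresEisenstein ρ hm k N hN hNo θ) = 0 := by
  haveI : Fintype (absoluteGaloisGroup L ⧸ N.comap (φ : absoluteGaloisGroup L →* absoluteGaloisGroup K)) :=
    @Fintype.ofFinite _ (finite_quotientComap N (φ : absoluteGaloisGroup L →* absoluteGaloisGroup K))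
  exact κ.pullback_coresEisenstein_eq_zero ρ hm k N hN hNo φ θ hθ

end Pullback

/-! ## §3 Unramified at `v`: the localisation of `coresEisenstein N θ` at a finite place -/

section Unramified

variable [NumberField K] (ρ : DiscreteGaloisModule K M) {m : ℕ} (hm : 1 ≤ m) (k : ℕ)
  (N : Subgroup (absoluteGaloisGroup K)) [N.Normal] (hN : N ≤ κ.layerSubgroup (eisensteinLevel (p := p) hm k))
  (hNo : IsOpen (N : Set (absoluteGaloisGroup K))) [Fintype (absoluteGaloisGroup K ⧸ N)]
  (v : HeightOneSpectrum (𝓞 K))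

/-- The continuous homomorphism `Γ_{(K_v)^{ur}} → Γ_{K_v} → Γ_K` of a finite place `v` (`(K_v)^{ur} =
IsNonarchimedeanLocalField.maxUnramified (K_v)`, `K_v = v.adicCompletion K`): the map along which a class is
pulled back to test «unramified at `v`» (`mem_unramifiedSubgroup_iff`, `galoisCohomology.res_comp`).
[cite: MilneADT2006, I §4] -/
abbrev unramifiedRestrictHom : absoluteGaloisGroup (IsNonarchimedeanLocalField.maxUnramified (v.adicCompletion K)) →ₜ*
    absoluteGaloisGroup K :=
  (absGaloisRestrict K (v.adicCompletion K)).comp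
    (absGaloisRestrict (v.adicCompletion K) (IsNonarchimedeanLocalField.maxUnramified (v.adicCompletion K)))

/-- **The corestriction of a class unramified above `v` is unramified at `v`** (for Howard's twisted coefficients
`M ⊗ A_{m,k}(ψ)`, e.g. `T_𝔮/p^k T_𝔮`): if every conjugate `g · θ` of `θ ∈ H¹(N, M)` dies on
`Γ_{(K_v)^{ur}} ×_{Γ_K} N` (i.e. `θ` restricted to the inertia groups of `K̄^N` at the places above `v` vanishes), then
the localisation at `v` of `coresEisenstein N θ` lies in the unramified subgroup
`H¹_{ur}(K_v, M ⊗ A_{m,k}(ψ)) = unramifiedSubgroup (GaloisRep.toLocal v (κ.eisensteinTwist ρ hm k)) 1` — the local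
condition of `F_𝔮` at the finite places `v ∤ p` outside `S`. [cite: Howard2004HeegnerKolyvagin, §2.1 and Lemma 2.2.7]
[cite: NeukirchSchmidtWingberg2008, I §5 (1.5.6)–(1.5.7)] [cite: MilneADT2006, I §4] -/
theorem res_coresEisenstein_mem_unramifiedSubgroup (θ : continuousCohomology 1 (subgroupRep ρ.toTopRep N))
    (hθ : ∀ g : absoluteGaloisGroup K,
      ContinuousCohomology.map (comapRestrict N (unramifiedRestrictHom v))
        (resPairHom ρ.toTopRep (DiscreteGaloisModule.toTopRep (ContinuousRep.restrict ρ (unramifiedRestrictHom v)))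
          (unramifiedRestrictHom v) (idPairHom ρ (unramifiedRestrictHom v)) N) 1
        (conjMap ρ.toTopRep N g 1 θ) = 0) :
    galoisCohomology.res (κ.eisensteinTwist ρ hm k) (v.adicCompletion K) 1 (κ.coresEisenstein ρ hm k N hN hNo θ) ∈
      unramifiedSubgroup (GaloisRep.toLocal v (κ.eisensteinTwist ρ hm k)) 1 := by
  change _ ∈ unramifiedSubgroup ((κ.eisensteinTwist ρ hm k).restrictField (v.adicCompletion K)) 1
  rw [DiscreteGaloisModule.mem_unramifiedSubgroup_iff, ← AddMonoidHom.comp_apply, galoisCohomology.res_comp]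
  exact κ.pullback_coresEisenstein_eq_zero' ρ hm k N hN hNo (unramifiedRestrictHom v) θ hθ

end Unramified

end ZpExtension

end Literature.NumberTheory.EllipticCurves

end
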